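import Literature.NumberTheory.Rogawski1990.RankOneUnstableDeltaValueInert      -- ★ p08 (g14) I-4b: `exists_finHeckeValue_sub_inv_mul_sqrt_eq` (the Δ-value under the μ-guard)
import Literature.NumberTheory.Rogawski1990.RankOneUnstableUnitParity         -- ★ p08 (g14) FILE A: `rankOne_lhs_indicator_one_eq_of_eigenframe` (the orbital side at `f = 𝟙_{K_H}`)
import HarnessLib

/-!
# [Rogawski1990 Lemma 4.9.3; LabesseLanglands1979 §2] (R1-CM), road «R1LL-tree», (σ): the UNIT CERTIFICATE under the μ-guard — at an unramified inert place the left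
# side of (4.9.2) at `f = 𝟙_{K_H}` on the type-(1) torus is `μ_v(γ₃)⁻¹ · μ_w(δ)⁻¹ · (−1)^e` for `ord_w(γ₁ − γ₃) ≥ M₀` — EVENTUALLY CONSTANT (no `N`, no `q`)

Topic `NumberTheory/Rogawski1990`; namespace `Literature.NumberTheory.Rogawski1990`.  ONE THEOREM (no definition, no instance, no notation, no named fact, no `sorry`);
Mathlib-only footing.  Cell `pub/hodgecm-mathlib` (D-0151), crux H413 = `stmt-HodgeConjecture-24833`, line «N6nsGerm», stub `stub_N6nsR1LL` (#159 (R1-CM)); LEAD F0P3a-plan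
(g10) WORD T9-8 (σ) ∕ T9-10; architect A-p16 (g27) RULING A-1 (3) («(σ) = I-4 at `m = 0`, `φ = 1` — lands as a COROLLARY of I-4b»), A-10 (b) («(σ) stays with p08»).  HONEST
LABEL: HC_CM is proved only modulo the printed citations (the 2 remaining named inputs hLiu418, h413) until rung 0 closes; nothing printed is asserted here.

THE MATHEMATICS.  ★ FILE A (`rankOne_lhs_indicator_one_eq_of_eigenframe`, the UNGUARDED computation at `μ = 1`): on the type-(1) elliptic torus through the frame `Q`
(`δ Q = Q·diag(u)`, `u₀ ≠ u₁` of norm one, `|u₀ − u₁|_w = |ϖ_v|_w^N`), with `ν_H(K_H) = 1` and `m_H` canonical,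
`√(Π‖u₀ − u₁‖) · (2Φ(⟦(δ,γ₁)⟧, 𝟙_{K_H}) − Σ_{st} Φ) = √(Π‖u₀ − u₁‖) · (−1)^e · (−q)^N` (`e` the Gram-parity bit of the frame) — so the orbital bracket is `(−1)^e (−q)^N`.
★ I-4b (`exists_finHeckeValue_sub_inv_mul_sqrt_eq`, the Δ-VALUE under print's guard `μ|_{𝕀_{L⁺}} = ω_{L∕L⁺}`): `μ_v(u₀ − u₁)⁻¹ · √(Π‖u₀ − u₁‖) = μ_v(u₁)⁻¹ · C⁻¹ · (−1)^N q^{−N}`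
for `N ≥ M₀` (`C = μ_w(δ_skew) ≠ 0`).  Multiplying: the GUARDED left side of (4.9.2) at `f = 𝟙_{K_H}` is
  `μ_v(u₀ − u₁)⁻¹ · √(Π‖u₀ − u₁‖) · (2Φ − Σ_{st}Φ) = μ_v(u₁)⁻¹ · C⁻¹ · (−1)^e`   (`N ≥ M₀`),
INDEPENDENT of `N`: the `(−q)^N` of the vertex count cancels the `(−1)^N q^{−N}` of `Δ` exactly — Labesse–Langlands' «`Δ·Φ^κ` extends across the singular sub-torus» for
the unit, and the reason the unguarded letter (`μ = 1`: no `(−1)^N`) is false (★ `not_rankOneUnstableTransferNonsplit`).  This is I-4a∕I-4b at `m = 0`, `φ = 1`.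

* **`rankOne_lhs_indicator_eq_of_eigenframe_of_guard`** — `∃ M₀ C, C ≠ 0 ∧ ∀ (canonical m_H, ν_H(K_H) = 1, G-regular (δ, γ₁), Z(δ) compact, frame Q, N ≥ M₀),
  ∃ e ≤ 1, (parity ↔ e = 0) ∧ LHS(μ) = μ_v(u₁)⁻¹ · C⁻¹ · (−1)^e`.

## References
* [Rogawski1990] J. D. Rogawski, *Automorphic Representations of Unitary Groups in Three Variables*, Ann. of Math. Stud. 123 (1990): §4.9 Lemma 4.9.3 (4.9.2) p. 56,
  Prop. 4.9.1 (b) p. 55 (the unit at an unramified place).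
* [LabesseLanglands1979] J.-P. Labesse, R. P. Langlands, *L-indistinguishability for SL(2)*, Canad. J. Math. 31 (1979): §2.
* [Flicker1998UnitaryFL] Y. Z. Flicker, *Elementary proof of the fundamental lemma for a unitary group*, Canad. J. Math. 50 (1998): §6 p. 95.
-/

set_option autoImplicit false

noncomputable section

open MeasureTheory NumberField IsDedekindDomain Matrix Finset ValuativeRel
open scoped ValuativeRel Matrix MatrixGroups

namespace Literature.NumberTheory.Rogawski1990

open Literature.NumberTheory.Automorphic Literature.NumberTheory.Automorphic.UnitaryGroup Literature.NumberTheory.GaloisRepresentations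

/-- `2 ≤ q_v` (the residue field of a finite place has at least two elements). [cite: NeukirchANT1999, Ch. I §3] -/
private theorem two_le_natCard_quotient'' (L : Type) [Field L] [NumberField L] (v : HeightOneSpectrum (𝓞 ↥(maximalRealSubfield L))) :
    2 ≤ Nat.card (𝓞 ↥(maximalRealSubfield L) ⧸ v.asIdeal) := by
  classical
  haveI : Finite (𝓞 ↥(maximalRealSubfield L) ⧸ v.asIdeal) := Ideal.finiteQuotientOfFreeOfNeBot v.asIdeal v.ne_bot
  haveI : Nontrivial (𝓞 ↥(maximalRealSubfield L) ⧸ v.asIdeal) := Ideal.Quotient.nontrivial_iff.2 v.isPrime.ne_top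
  exact Finite.one_lt_card

section Lhs

variable (L : Type) [Field L] [NumberField L] [IsCMField L] (v : HeightOneSpectrum (𝓞 ↥(maximalRealSubfield L)))
  (w : PlacesOver L v) (hw : IsCMField.complexConj L • w.1 = w.1)

variable
  [MeasurableSpace ((cmDatum L 2 (Matrix.of fun i j : Fin 2 => if i.val + j.val + 1 = 2 then (1 : L) else 0)).Local v × (cmDatum L 1 (Matrix.of fun i j : Fin 1 => if i.val + j.val + 1 = 1 then (1 : L) else 0)).Local v)] [BorelSpace ((cmDatum L 2 (Matrix.of fun i j : Fin 2 => if i.val + j.val + 1 = 2 then (1 : L) else 0)).Local v × (cmDatum L 1 (Matrix.of fun i j : Fin 1 => if i.val + j.val + 1 = 1 then (1 : L) else 0)).Local v)]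
  [∀ a : (cmDatum L 2 (Matrix.of fun i j : Fin 2 => if i.val + j.val + 1 = 2 then (1 : L) else 0)).Local v × (cmDatum L 1 (Matrix.of fun i j : Fin 1 => if i.val + j.val + 1 = 1 then (1 : L) else 0)).Local v, MeasurableSpace (((cmDatum L 2 (Matrix.of fun i j : Fin 2 => if i.val + j.val + 1 = 2 then (1 : L) else 0)).Local v × (cmDatum L 1 (Matrix.of fun i j : Fin 1 => if i.val + j.val + 1 = 1 then (1 : L) else 0)).Local v) ⧸ Subgroup.centralizer ({a} : Set ((cmDatum L 2 (Matrix.of fun i j : Fin 2 => if i.val + j.val + 1 = 2 then (1 : L) else 0)).Local v × (cmDatum L 1 (Matrix.of fun i j : Fin 1 => if i.val + j.val + 1 = 1 then (1 : L) else 0)).Local v)))]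
  [∀ a : (cmDatum L 2 (Matrix.of fun i j : Fin 2 => if i.val + j.val + 1 = 2 then (1 : L) else 0)).Local v × (cmDatum L 1 (Matrix.of fun i j : Fin 1 => if i.val + j.val + 1 = 1 then (1 : L) else 0)).Local v, BorelSpace (((cmDatum L 2 (Matrix.of fun i j : Fin 2 => if i.val + j.val + 1 = 2 then (1 : L) else 0)).Local v × (cmDatum L 1 (Matrix.of fun i j : Fin 1 => if i.val + j.val + 1 = 1 then (1 : L) else 0)).Local v) ⧸ Subgroup.centralizer ({a} : Set ((cmDatum L 2 (Matrix.of fun i j : Fin 2 => if i.val + j.val + 1 = 2 then (1 : L) else 0)).Local v × (cmDatum L 1 (Matrix.of fun i j : Fin 1 => if i.val + j.val + 1 = 1 then (1 : L) else 0)).Local v)))]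
  (νH : Measure ((cmDatum L 2 (Matrix.of fun i j : Fin 2 => if i.val + j.val + 1 = 2 then (1 : L) else 0)).Local v × (cmDatum L 1 (Matrix.of fun i j : Fin 1 => if i.val + j.val + 1 = 1 then (1 : L) else 0)).Local v)) [νH.IsHaarMeasure] [νH.IsMulRightInvariant]


include hw in
/-- **(σ) THE UNIT CERTIFICATE UNDER THE μ-GUARD.**  At a non-split place `v` unramified in the CM field `L`, for `μ` with `μ|_{𝕀_{L⁺}} = ω_{L∕L⁺}` there are `M₀` and `C ≠ 0`
(those of ★ `exists_finHeckeValue_sub_inv_mul_sqrt_eq`: the level of `μ_w` and `C = μ_w(δ_skew)`) such that for every canonical `m_H` (`ν_H(K_H) = 1`), every `G`-regular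
`(δ, γ₁)` with `Z(δ)` compact and eigenframe `δ Q = Q·diag(u)` (`u₀ ≠ u₁` of norm one), and `|u₀ − u₁|_w = |ϖ_v|_w^N` with `N ≥ M₀`:
`μ_v(u₀ − u₁)⁻¹ · √(Π_w‖u₀ − u₁‖) · (2Φ(⟦(δ,γ₁)⟧, 𝟙_{K_H}) − Σᶠ_{d ∼_st} Φ(d, 𝟙_{K_H})) = μ_v(u₁)⁻¹ · C⁻¹ · (−1)^e`, `e ∈ {0,1}` the Gram-parity bit of the frame — the guarded
left side of (4.9.2) at the unit is EVENTUALLY CONSTANT along the torus (★ FILE A's `(−1)^e(−q)^N` times ★ I-4b's `(−1)^N q^{−N}`).  Print: Prop. 4.9.1 (b) (the unit transfers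
at an unramified place), Lemma 4.9.3 (4.9.2). [cite: Rogawski1990, §4.9 Lemma 4.9.3 (4.9.2) p. 56; Prop. 4.9.1 (b) p. 55] [cite: LabesseLanglands1979, §2]
[cite: Flicker1998UnitaryFL, §6 p. 95] -/
theorem rankOne_lhs_indicator_eq_of_eigenframe_of_guard (hunr : Algebra.IsUnramifiedIn (𝓞 L) v.asIdeal) (μ : HeckeCharacter L)
    (hμω : ∀ x : ideleGroup ↥(maximalRealSubfield L), μ (AdeleRing.ideleBaseChange ↥(maximalRealSubfield L) L x) = quadraticHeckeCharCM L x) :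
    ∃ (M₀ : ℕ) (C : ℂ), C ≠ 0 ∧ ∀
    {mH : OrbitalMeasureFamily ((cmDatum L 2 (Matrix.of fun i j : Fin 2 => if i.val + j.val + 1 = 2 then (1 : L) else 0)).Local v × (cmDatum L 1 (Matrix.of fun i j : Fin 1 => if i.val + j.val + 1 = 1 then (1 : L) else 0)).Local v)} (hmH : mH.IsCanonical (IsLocalGRegular L v) νH)
    (hνH : νH (((cmLocalIntegralLevel L 2 (Matrix.of fun i j : Fin 2 => if i.val + j.val + 1 = 2 then (1 : L) else 0) v).prod (cmLocalIntegralLevel L 1 (Matrix.of fun i j : Fin 1 => if i.val + j.val + 1 = 1 then (1 : L) else 0) v) : Subgroup ((cmDatum L 2 (Matrix.of fun i j : Fin 2 => if i.val + j.val + 1 = 2 then (1 : L) else 0)).Local v × (cmDatum L 1 (Matrix.of fun i j : Fin 1 => if i.val + j.val + 1 = 1 then (1 : L) else 0)).Local v)) : Set ((cmDatum L 2 (Matrix.of fun i j : Fin 2 => if i.val + j.val + 1 = 2 then (1 : L) else 0)).Local v × (cmDatum L 1 (Matrix.of fun i j : Fin 1 => if i.val + j.val + 1 = 1 then (1 : L)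 else 0)).Local v)) = 1)
    (δ : (cmDatum L 2 (Matrix.of fun i j : Fin 2 => if i.val + j.val + 1 = 2 then (1 : L) else 0)).Local v) (γ₁ : (cmDatum L 1 (Matrix.of fun i j : Fin 1 => if i.val + j.val + 1 = 1 then (1 : L) else 0)).Local v) (hγ : IsLocalGRegular L v (δ, γ₁))
    [CompactSpace (Subgroup.centralizer ({δ} : Set ((cmDatum L 2 (Matrix.of fun i j : Fin 2 => if i.val + j.val + 1 = 2 then (1 : L) else 0)).Local v)))]
    {Q : GL (Fin 2) (LocalRing L v)} {u : Fin 2 → LocalRing L v}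
    (hQ : δ.val.val * Q.val = Q.val * diagonal u)
    (hu : Function.Injective u) (hu1 : ∀ i, conjLocal L (IsCMField.complexConj L) v (u i) * u i = 1) {N : ℕ} (hMN : M₀ ≤ N)
    (hN : valuation (w.1.adicCompletion L) (u 0 w - u 1 w) = valuation (w.1.adicCompletion L) ((toPlace v w (HeckeCharacter.uniformizer ↥(maximalRealSubfield L) v : v.adicCompletion ↥(maximalRealSubfield L))) ^ N)),
    ∃ e : ℕ, e ≤ 1 ∧
      (Even (WithZero.log (Valued.v ((twistGram (conjLocal L (IsCMField.complexConj L) v) ((adelicForm L 2 (Matrix.of fun i j : Fin 2 => if i.val + j.val + 1 = 2 then (1 : L) else 0)).map (adeleToLocal L v)) Q.val 0 0) w))) ↔ e = 0) ∧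
      ((finHeckeValue L v μ
          (((Q⁻¹).val * (δ.val.val : Matrix (Fin 2) (Fin 2) (LocalRing L v)) * Q.val) 0 0 - ((Q⁻¹).val * (δ.val.val : Matrix (Fin 2) (Fin 2) (LocalRing L v)) * Q.val) 1 1))⁻¹ : ℂ) *
        ((Real.sqrt (∏ w' : PlacesOver L v,
            ‖(((Q⁻¹).val * (δ.val.val : Matrix (Fin 2) (Fin 2) (LocalRing L v)) * Q.val) 0 0 - ((Q⁻¹).val * (δ.val.val : Matrix (Fin 2) (Fin 2) (LocalRing L v)) * Q.val) 1 1) w'‖) : ℝ) : ℂ) *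
        (2 * classOrbitalIntegral mH ((((cmLocalIntegralLevel L 2 (Matrix.of fun i j : Fin 2 => if i.val + j.val + 1 = 2 then (1 : L) else 0) v).prod (cmLocalIntegralLevel L 1 (Matrix.of fun i j : Fin 1 => if i.val + j.val + 1 = 1 then (1 : L) else 0) v) : Subgroup ((cmDatum L 2 (Matrix.of fun i j : Fin 2 => if i.val + j.val + 1 = 2 then (1 : L) else 0)).Local v × (cmDatum L 1 (Matrix.of fun i j : Fin 1 => if i.val + j.val + 1 = 1 then (1 : L) else 0)).Local v)) : Set ((cmDatum L 2 (Matrix.of fun i j : Fin 2 => if i.val + j.val + 1 = 2 then (1 : L) else 0)).Local v × (cmDatum L 1 (Matrix.of fun i j : Fin 1 => if i.val + j.val + 1 = 1 then (1 : L) else 0)).Local v)).indicator fun _ => (1 : ℂ)) (ConjClasses.mk (δ, γ₁)) -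
          ∑ᶠ d ∈ {d : ConjClasses ((cmDatum L 2 (Matrix.of fun i j : Fin 2 => if i.val + j.val + 1 = 2 then (1 : L) else 0)).Local v × (cmDatum L 1 (Matrix.of fun i j : Fin 1 => if i.val + j.val + 1 = 1 then (1 : L) else 0)).Local v) | IsLocalStablyConjH L v (δ, γ₁) (Quotient.out d)},
            classOrbitalIntegral mH ((((cmLocalIntegralLevel L 2 (Matrix.of fun i j : Fin 2 => if i.val + j.val + 1 = 2 then (1 : L) else 0) v).prod (cmLocalIntegralLevel L 1 (Matrix.of fun i j : Fin 1 => if i.val + j.val + 1 = 1 then (1 : L) else 0) v) : Subgroup ((cmDatum L 2 (Matrix.of fun i j : Fin 2 => if i.val + j.val + 1 = 2 then (1 : L) else 0)).Local v × (cmDatum L 1 (Matrix.of fun i j : Fin 1 => if i.val + j.val + 1 = 1 then (1 : L) else 0)).Local v)) : Set ((cmDatum L 2 (Matrix.of fun i j : Fin 2 => if i.val + j.val + 1 = 2 then (1 : L) else 0)).Local v × (cmDatum L 1 (Matrix.of fun i j : Fin 1 => if i.val + j.val + 1 = 1 then (1 : L) else 0)).Local v)).indicator fun _ => (1 : ℂ))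 d) =
        (finHeckeValue L v μ (u 1))⁻¹ * C⁻¹ * (-1 : ℂ) ^ e := by
  haveI : Algebra.IsQuadraticExtension ↥(maximalRealSubfield L) L := IsCMField.isQuadraticExtension L
  have hv : Subsingleton (PlacesOver L v) :=
    PlacesOver.subsingleton_of_smul_eq (IsCMField.complexConj L) (IsCMField.complexConj_ne_one L) w hw
  obtain ⟨M₀, C, hC, hmain⟩ := exists_finHeckeValue_sub_inv_mul_sqrt_eq L v w hw hunr μ hμω
  refine ⟨M₀, C, hC, ?_⟩
  intro mH hmH hνH δ γ₁ hγ _ Q u hQ hu hu1 N hMN hN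
  obtain ⟨e, he, hpar, h1⟩ := rankOne_lhs_indicator_one_eq_of_eigenframe L v w hw νH hunr hmH hνH δ γ₁ hγ hQ hu hu1 hN
  refine ⟨e, he, hpar, ?_⟩
  -- the frame reading `Q⁻¹ δ Q = diag(u)`
  have hdiag : (Q⁻¹).val * (δ.val.val : Matrix (Fin 2) (Fin 2) (LocalRing L v)) * Q.val = diagonal u := unitsInv_mul_mul_eq_diagonal_of_eigenframe hQ
  have h00 : ((Q⁻¹).val * (δ.val.val : Matrix (Fin 2) (Fin 2) (LocalRing L v)) * Q.val) 0 0 = u 0 := by rw [hdiag, diagonal_apply_eq]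
  have h11 : ((Q⁻¹).val * (δ.val.val : Matrix (Fin 2) (Fin 2) (LocalRing L v)) * Q.val) 1 1 = u 1 := by rw [hdiag, diagonal_apply_eq]
  rw [h00, h11] at h1 ⊢
  -- `u₀ − u₁` is a unit (non-zero at the one place `w`), so `μ_v|_{μ=1}(u₀ − u₁) = 1` and `√(Π‖u₀ − u₁‖) > 0`
  have hN' : Valued.v (u 0 w - u 1 w) =
      Valued.v ((toPlace v w (HeckeCharacter.uniformizer ↥(maximalRealSubfield L) v : v.adicCompletion ↥(maximalRealSubfield L))) ^ N) :=
    (v_eq_iff_valuation_eq _ _).2 hN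
  have hw0 : u 0 w - u 1 w ≠ 0 := by
    intro h0
    rw [h0, map_zero] at hN'
    exact (Valuation.ne_zero_iff _).2 (pow_ne_zero _ (toPlace_uniformizer_ne_zero L v w hunr)) hN'.symm
  have hne : u 0 - u 1 ≠ 0 := fun h0 => hw0 (by rw [← Pi.sub_apply, h0, Pi.zero_apply])
  have hunit : IsUnit (u 0 - u 1) := isUnit_localRing_of_ne_zero_of_subsingleton L v hv hne
  have hspos : (0 : ℝ) < Real.sqrt (∏ w' : PlacesOver L v, ‖(u 0 - u 1) w'‖) := by
    refine Real.sqrt_pos.2 (Finset.prod_pos fun w' _ => norm_pos_iff.2 ?_)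
    obtain rfl : w = w' := Subsingleton.elim w w'
    rw [Pi.sub_apply]
    exact hw0
  have hs0 : ((Real.sqrt (∏ w' : PlacesOver L v, ‖(u 0 - u 1) w'‖) : ℝ) : ℂ) ≠ 0 := Complex.ofReal_ne_zero.2 hspos.ne'
  rw [finHeckeValue_one L v hunit, inv_one, one_mul] at h1
  -- the orbital bracket is `(−1)^e (−q)^N`
  have hB := mul_left_cancel₀ hs0 h1
  -- the Δ-value under the guard
  have h2 := hmain (u 0) (u 1) N hMN (hu1 0) (hu1 1) (by rw [← Pi.sub_apply]; exact hN')
  have hq : ((Nat.card (𝓞 ↥(maximalRealSubfield L) ⧸ v.asIdeal) : ℂ) ^ N) ≠ 0 :=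
    pow_ne_zero _ (Nat.cast_ne_zero.2 (Nat.pos_iff_ne_zero.1 (lt_of_lt_of_le (by norm_num) (two_le_natCard_quotient'' L v))))
  have hsq : (-1 : ℂ) ^ N * (-1 : ℂ) ^ N = 1 := by rw [← pow_add, ← two_mul, pow_mul, neg_one_sq, one_pow]
  have key : ((-1 : ℂ) ^ N * (((Nat.card (𝓞 ↥(maximalRealSubfield L) ⧸ v.asIdeal) : ℂ) ^ N))⁻¹) *
      ((-1 : ℂ) ^ e * ((-1 : ℂ) ^ N * (Nat.card (𝓞 ↥(maximalRealSubfield L) ⧸ v.asIdeal) : ℂ) ^ N)) = (-1 : ℂ) ^ e := by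
    calc _ = (-1 : ℂ) ^ e * ((-1 : ℂ) ^ N * (-1 : ℂ) ^ N) *
          ((((Nat.card (𝓞 ↥(maximalRealSubfield L) ⧸ v.asIdeal) : ℂ) ^ N))⁻¹ * (Nat.card (𝓞 ↥(maximalRealSubfield L) ⧸ v.asIdeal) : ℂ) ^ N) := by ring
      _ = (-1 : ℂ) ^ e := by rw [hsq, inv_mul_cancel₀ hq, mul_one, mul_one]
  rw [hB, ← mul_assoc, h2]
  calc _ = (finHeckeValue L v μ (u 1))⁻¹ * C⁻¹ * (((-1 : ℂ) ^ N * (((Nat.card (𝓞 ↥(maximalRealSubfield L) ⧸ v.asIdeal) : ℂ) ^ N))⁻¹) *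
      ((-1 : ℂ) ^ e * ((-1 : ℂ) ^ N * (Nat.card (𝓞 ↥(maximalRealSubfield L) ⧸ v.asIdeal) : ℂ) ^ N))) := by ring
    _ = _ := by rw [key]

end Lhs

end Literature.NumberTheory.Rogawski1990

end
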